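import Summits.PneNP.PneNP.Theorems.ChebyshevTracialDesignRectangleBiMode
import Literature.Combinatorics.Optimization.TracialDesigns
import HarnessLib

/-!
# Cell pnp-psdrank, route `ChebyshevTracialDesign`: the value of a multilevel planted weight on a 0/1 rectangle,
# decomposed over the even Johnson layers (exact bi-mode form of the design value, r = 1)

Harmonic backbone, brick 9 (MEMO-7 (C2)/(C3) in the route's own vocabulary). For the multilevel planted weight
`levelWeight n t C w` of the route (`Literature.Combinatorics.Optimization.TracialDesigns`: `W(U,M) = Σ_{c ∈ C} w_c 1[(U,M) ∈ Q_c(t)]/|Q_c(t)|`,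
Rothvoß's two-level weight being `C = {3,k}` [cite: Rothvoss2017, §2 (PDF p. 6, eq. (2))]), every family `X` of `t`-cuts (`t = 2l+1`,
`2t ≤ n+1`), every set `Y` of perfect matchings and all odd levels `C ⊆ [0,t]`:
  `Σ_{U ∈ X} Σ_{M ∈ Y} W(U,M) = Σ_{κ ≤ l} (t−2κ)! · ( Σ_{c ∈ C} (w_c/|Q_c|) · σ̃_{2κ}(c) ) · B_κ(X,Y)`      (`rectangle_value_eq_bimode`)
with the EXPLICIT level coefficients `σ̃_{2κ}(c)` of brick 7 (MEMO-7 (★)) and the level-free bilinear terms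
`B_κ(X,Y) = Σ_{M ∈ Y} Σ_{T M-closed, |T| = 2κ} (p_{2κ})_T` (`p_j` = the ladder decomposition of `1_X`, brick 8). So the value of an exact design
against ANY 0/1 rectangle is a finite sum over the even modes `κ` of (design moment of the degree-κ-in-`c` profile `σ̃_{2κ}(c)/|Q_c|`) × `B_κ`:
the object the crux's virtual-positivity question is about, now with closed-form coefficients
[cite: GodsilMeagher2015, §15.2 (perfect matching scheme)]. WHAT THIS IS NOT: no design is applied (that needs eng's half-degree law for
`σ̃_{2κ}(c)/|Q_c|` in this normalisation) and no bound on `B_κ`; nothing on psd rank. Supports crux stmt-PneNP-19878.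
-/

set_option linter.dupNamespace false -- `Summit.PneNP.PneNP.…`: summit = sub-problem (D-0017)

noncomputable section

namespace Summit.PneNP.PneNP.Theorems.ChebyshevTracialDesignDesignValueBiMode

open Finset Literature.Combinatorics.AssociationSchemes Literature.Combinatorics.AssociationSchemes.JohnsonHarmonics
open Literature.Barriers.PneNP Literature.Combinatorics.Optimization
open Summit.PneNP.PneNP.Theorems.ChebyshevTracialDesignRectangleBiMode
open Summit.PneNP.PneNP.Theorems.ChebyshevTracialDesignSaturatedSubsets
open Summit.PneNP.PneNP.Theorems.ChebyshevTracialDesignTightColumnSums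
open Summit.PneNP.PneNP.Theorems.ChebyshevTracialDesignInvolutionKeys

variable {n : ℕ}

/-- The rectangle sum of a level weight is the weighted sum of the level counts of its columns. -/
theorem rectangle_sum_levelWeight (t : ℕ) (C : Finset ℕ) (w : ℕ → ℝ) (X : Finset (OddSet n)) (hX : ∀ U ∈ X, U.1.card = t)
    (Y : Finset (PMatch n)) :
    ∑ U ∈ X, ∑ M ∈ Y, levelWeight n t C w U M =
      ∑ c ∈ C, (w c / ((Qset n t c).card : ℝ)) * ∑ M ∈ Y, ((X.filter fun U => cc U M = c).card : ℝ) := by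
  classical
  unfold levelWeight
  -- move the level sum outside
  have h1 : ∑ U ∈ X, ∑ M ∈ Y, ∑ c ∈ C, (if (U, M) ∈ Qset n t c then w c / ((Qset n t c).card : ℝ) else 0) =
      ∑ c ∈ C, ∑ M ∈ Y, ∑ U ∈ X, (if (U, M) ∈ Qset n t c then w c / ((Qset n t c).card : ℝ) else 0) := by
    rw [Finset.sum_comm]
    refine (sum_congr rfl fun M _ => ?_).trans Finset.sum_comm
    exact Finset.sum_comm
  rw [h1]
  refine sum_congr rfl fun c _ => ?_
  rw [mul_sum]
  refine sum_congr rfl fun M _ => ?_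
  rw [card_filter, Nat.cast_sum, mul_sum]
  refine sum_congr rfl fun U hU => ?_
  have hiff : (U, M) ∈ Qset n t c ↔ cc U M = c := by
    rw [mem_Qset_iff]; simp only [hX U hU, true_and]
  by_cases h : cc U M = c
  · rw [if_pos (hiff.2 h), if_pos h]; simp
  · rw [if_neg (fun h' => h (hiff.1 h')), if_neg h]; simp

/-- A level count of a family of `t`-cuts of `OddSet n`, as a count of the underlying `t`-subsets by inner-key number
(`cc = t − 2e`). -/
theorem card_filter_cc_eq_card_filter_innerKeys {l : ℕ} (X : Finset (OddSet n)) (hX : ∀ U ∈ X, U.1.card = 2 * l + 1)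
    (M : PMatch n) {c : ℕ} (hc : c ≤ 2 * l + 1 ∧ Odd c) :
    (X.filter fun U => cc U M = c).card =
      ((X.image Subtype.val).filter fun U =>
        (U.filter fun x => x < M.2.partner x ∧ M.2.partner x ∈ U).card = (2 * l + 1 - c) / 2).card := by
  classical
  rw [← card_image_of_injective (X.filter fun U => cc U M = c) Subtype.val_injective]
  congr 1
  ext U'
  simp only [mem_image, mem_filter]
  obtain ⟨m, hm⟩ := hc.2
  constructor
  · rintro ⟨U, ⟨hUX, hcc⟩, rfl⟩
    refine ⟨⟨U, hUX, rfl⟩, ?_⟩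
    have h := card_eq_cc_add U M
    rw [hX U hUX, hcc] at h
    omega
  · rintro ⟨⟨U, hUX, rfl⟩, he⟩
    refine ⟨U, ⟨hUX, ?_⟩, rfl⟩
    have h := card_eq_cc_add U M
    rw [hX U hUX, he] at h
    omega

/-- **The value of a multilevel weight on a 0/1 rectangle, mode by mode** (exact; r = 1). For `t = 2l+1` with `2t ≤ n+1`, odd
levels `C ⊆ [0,t]`, any weights `w`, any family `X` of `t`-cuts and any set `Y` of perfect matchings, there are harmonic `p_j` (the
ladder decomposition of `1_X`) with
`Σ_{U∈X} Σ_{M∈Y} levelWeight n t C w U M = Σ_{κ≤l} (t−2κ)! · (Σ_{c∈C} (w_c/|Q_c|)·σ̃_{2κ}(c)) · Σ_{M∈Y} Σ_{T M-closed, |T|=2κ} (p_{2κ})_T`,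
`σ̃_{2κ}(c) = Σ_{a ≥ max((t−c)/2, κ)} (−1)^{a−(t−c)/2} C(a,(t−c)/2)·Π_{i<t−2a}(n−2a−2κ−i)/(t−2a)!·C(n/2−2κ, a−κ)`. -/
theorem rectangle_value_eq_bimode {l : ℕ} (hl : 2 * (2 * l + 1) ≤ n + 1) (C : Finset ℕ)
    (hC : ∀ c ∈ C, c ≤ 2 * l + 1 ∧ Odd c) (w : ℕ → ℝ) (X : Finset (OddSet n)) (hX : ∀ U ∈ X, U.1.card = 2 * l + 1)
    (Y : Finset (PMatch n)) :
    ∃ p : ℕ → (Finset (Fin n) → ℝ), (∀ j, IsHarmonic j (p j)) ∧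
      ∑ U ∈ X, ∑ M ∈ Y, levelWeight n (2 * l + 1) C w U M =
        ∑ κ ∈ range (l + 1), ((2 * l + 1 - 2 * κ).factorial : ℝ) *
          ((∑ c ∈ C, w c / ((Qset n (2 * l + 1) c).card : ℝ) *
              ∑ a ∈ range (l + 1), (if (2 * l + 1 - c) / 2 ≤ a ∧ κ ≤ a then
                (-1 : ℝ) ^ (a - (2 * l + 1 - c) / 2) * (a.choose ((2 * l + 1 - c) / 2) : ℝ) *
                  ((∏ i ∈ range (2 * l + 1 - 2 * a), ((n : ℝ) - (2 * a : ℕ) - (2 * κ : ℕ) - i)) /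
                    ((2 * l + 1 - 2 * a).factorial : ℝ)) *
                  (((n / 2 - 2 * κ).choose (a - κ) : ℕ) : ℝ) else 0)) *
            ∑ M ∈ Y, ∑ T ∈ univ.filter (fun T : Finset (Fin n) => (T.filter fun x => M.2.partner x ∈ T).card = 2 * κ),
              p (2 * κ) T) := by
  classical
  have hX' : X.image Subtype.val ⊆ powersetCard (2 * l + 1) (univ : Finset (Fin n)) := by
    intro U' hU'
    obtain ⟨U, hU, rfl⟩ := mem_image.1 hU'
    exact mem_powersetCard.2 ⟨subset_univ _, hX U hU⟩
  obtain ⟨p, hp, hbm⟩ := card_filter_level_eq_bimode hl (X.image Subtype.val) hX'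
  refine ⟨p, hp, ?_⟩
  rw [rectangle_sum_levelWeight _ C w X hX Y]
  -- abbreviations
  set F : ℕ → ℝ := fun κ => ((2 * l + 1 - 2 * κ).factorial : ℝ) with hF
  set S : ℕ → ℕ → ℝ := fun κ e₀ => ∑ a ∈ range (l + 1), (if e₀ ≤ a ∧ κ ≤ a then
      (-1 : ℝ) ^ (a - e₀) * (a.choose e₀ : ℝ) *
        ((∏ i ∈ range (2 * l + 1 - 2 * a), ((n : ℝ) - (2 * a : ℕ) - (2 * κ : ℕ) - i)) /
          ((2 * l + 1 - 2 * a).factorial : ℝ)) *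
        (((n / 2 - 2 * κ).choose (a - κ) : ℕ) : ℝ) else 0) with hS
  set Q : ℕ → PMatch n → ℝ := fun κ M =>
    ∑ T ∈ univ.filter (fun T : Finset (Fin n) => (T.filter fun x => M.2.partner x ∈ T).card = 2 * κ), p (2 * κ) T with hQ
  -- each level count, mode by mode
  have hcount : ∀ c ∈ C, ∀ M ∈ Y, ((X.filter fun U => cc U M = c).card : ℝ) =
      ∑ κ ∈ range (l + 1), F κ * (S κ ((2 * l + 1 - c) / 2) * Q κ M) := by
    intro c hc M _
    rw [card_filter_cc_eq_card_filter_innerKeys X hX M (hC c hc),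
      hbm M.2.partner (partner_invol M).1 (partner_invol M).2 ((2 * l + 1 - c) / 2)]
    have hkeys : ((univ : Finset (Fin n)).filter fun x => x < M.2.partner x).card = n / 2 := by
      have := two_mul_card_keys (partner_invol M).1 (partner_invol M).2
      omega
    simp only [hkeys, hF, hS, hQ]
  -- rearrange the triple sum
  have hL : ∑ c ∈ C, w c / ((Qset n (2 * l + 1) c).card : ℝ) * ∑ M ∈ Y, ((X.filter fun U => cc U M = c).card : ℝ) =
      ∑ c ∈ C, ∑ M ∈ Y, ∑ κ ∈ range (l + 1),
        w c / ((Qset n (2 * l + 1) c).card : ℝ) * F κ * S κ ((2 * l + 1 - c) / 2) * Q κ M := by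
    refine sum_congr rfl fun c hc => ?_
    rw [mul_sum]
    refine sum_congr rfl fun M hM => ?_
    rw [hcount c hc M hM, mul_sum]
    exact sum_congr rfl fun κ _ => by ring
  rw [hL]
  -- the right-hand side, expanded
  have hR : ∑ κ ∈ range (l + 1), F κ * ((∑ c ∈ C, w c / ((Qset n (2 * l + 1) c).card : ℝ) * S κ ((2 * l + 1 - c) / 2)) *
      ∑ M ∈ Y, Q κ M) =
      ∑ c ∈ C, ∑ M ∈ Y, ∑ κ ∈ range (l + 1),
        w c / ((Qset n (2 * l + 1) c).card : ℝ) * F κ * S κ ((2 * l + 1 - c) / 2) * Q κ M := by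
    have hexp : ∀ κ ∈ range (l + 1), F κ * ((∑ c ∈ C, w c / ((Qset n (2 * l + 1) c).card : ℝ) * S κ ((2 * l + 1 - c) / 2)) *
        ∑ M ∈ Y, Q κ M) =
        ∑ c ∈ C, ∑ M ∈ Y, w c / ((Qset n (2 * l + 1) c).card : ℝ) * F κ * S κ ((2 * l + 1 - c) / 2) * Q κ M := by
      intro κ _
      rw [sum_mul_sum, mul_sum]
      refine sum_congr rfl fun c _ => ?_
      rw [mul_sum]
      exact sum_congr rfl fun M _ => by ring
    rw [sum_congr rfl hexp, Finset.sum_comm]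
    refine sum_congr rfl fun c _ => ?_
    rw [Finset.sum_comm]
  rw [← hR]

end Summit.PneNP.PneNP.Theorems.ChebyshevTracialDesignDesignValueBiMode
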